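import Summits.BirchSwinnertonDyer.BirchSwinnertonDyer.Theorems.ByReductionTypeAtTwoRankOneAtTwoOffBigImageOddLocalEnginePrescribedPrime
import Literature.NumberTheory.EllipticCurves.HeegnerPointsKolyvaginPrimaryRamifiedProofs
import HarnessLib

/-!
# Route `ByReductionTypeAtTwo`, crux `RankOneAtTwoOffBigImageOddLocal` (stmt-BirchSwinnertonDyer-23716), line
# `refined_kolyvagin_tamagawa_shift_at_two` — ENGINE PORT, card E4-γ: the finite-group core of McCallum's Prop. 4.4 (2) `ker χ_ℓ = 2^M Ẽ(𝔽_λ)` AT `p = 2`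

Lead prover `prover-cruxlead-stmt-BirchSwinnertonDyer-23716-g2` (2026-08-28).  The first (γ)-CONSUMER of the line card's E4 inventory ported
to `p = 2`: the tree proves McCallum 1991 Prop. 4.4 (2) — «`ker χ_l = p^M E(F_λ)`», the local heart of the Kolyvagin relation
`c_M(mℓ)_λ = χ_ℓ(P_m)` — as `Literature.NumberTheory.EllipticCurves.KolyvaginChi.sub_eq_zero_iff_exists_pow_zsmul_eq` under the printed
hypothesis `p ≠ 2`, through the `±`-eigen-decomposition of `C = Ẽ(𝔽_λ)[p^∞]` under `φ = Frob(ℓ)` (`exists_eigen_add_eigen`, which divides by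
`2`) and the cyclicity of each eigenspace.  At `p = 2` that decomposition does not exist; the sibling route's crux `KolyvaginRelationAtTwo`
(stmt-BirchSwinnertonDyer-24880) records exactly this as its risk.  This file proves the `p = 2` statement in the two cases that exhaust the
Kolyvagin primes at `2`, and isolates what the REGULAR Frobenius buys.  Notation: `ℓ + 1 = 2^M l'`, `a_ℓ = 2^M a'` (`M = M(ℓ) = min(v₂(ℓ+1), v₂(a_ℓ))`,
so at least one of `l'`, `a'` is odd), `χ(c) = a' c - l' φ(c)`, and the characteristic relation `(ℓ+1) c = a_ℓ φ(c)` on `C` (`Frob(ℓ)² = 1` on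
`Ẽ(𝔽_{ℓ²})`).

* §1 `KolyvaginChiTwo.sub_eq_zero_iff_exists_zsmul_eq_of_isCoprime` — **UNEQUAL VALUATIONS `v₂(a_ℓ) ≠ v₂(ℓ+1)` (i.e. `a'² - l'²` odd), ANY
  Frobenius type, ANY finite `C`, NO eigen-structure, NO cyclicity:** if `q` is coprime to `a'² - l'²` and `(q l') c = (q a') φ(c)` on `C`, then
  `χ(b) = 0 ↔ b ∈ qC`.  Proof: `q χ = 0` gives `qC ⊆ ker χ` and `im χ ⊆ C[q]`; on `C[q]`, `χ(c) = 0 ⇒ (a'² - l'²) c = 0 ⇒ c = 0`, so `χ`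
  restricts to a bijection of the finite group `C[q]`, whence `im χ = C[q]` and `#ker χ = #C / #C[q] = #qC`.  (Stated for every integer `q`;
  at `q = p^M`, `p` odd, it also covers the tree's case `p ∤ (l' - a')(l' + a')` without eigenvectors.)  In particular EVERY SHARP prime
  (`v₂(a_ℓ) = M < v₂(ℓ+1)`, filter `SharpAtTwo`) and every prime with `v₂(a_ℓ) > v₂(ℓ+1) = M` (e.g. `a_ℓ = 0`) satisfies Prop. 4.4 (2) at `2`
  whatever `ρ̄(Frob ℓ)` is.
* §2 `KolyvaginChiTwo.sub_eq_zero_iff_exists_pow_zsmul_eq_of_relations` — **EQUAL VALUATIONS `v₂(a_ℓ) = v₂(ℓ+1) = M` (both `a'`, `l'` odd):**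
  here `ker χ = 2^M C` is a property of the `ℤ[φ]`-MODULE STRUCTURE of `C`, and it holds when `C` is `ℤ[φ]`-CYCLIC (generator `g`: every
  `c = i•g + j•φ g`) with relation lattice the odd saturation of `⟨(2^M l', -2^M a'), (-2^M a', 2^M l')⟩` — which is the structure
  `C ≅ ℤ₂[φ]/2^M(l' - a'φ)` that a REGULAR `Frob(ℓ)` (odd on `E[2]`, so `T₂Ẽ` is `ℤ₂[Frob]`-free of rank one) forces on `Ẽ(𝔽_{ℓ²})[2^∞]`, of order
  `|(ℓ+1)² - a_ℓ²|₂`.  Proof: pure `2 × 2` integer algebra (`a'u = l'v ∧ a'v = l'u ⇒ u = v = 0` as `a'² ≠ l'²`), then division by the odd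
  saturation index inside the `2`-group `C`.  For a NON-cyclic structure (e.g. `C ≅ ℤ₂[φ]/2^M 𝔪`, `𝔪 = (2, φ - 1)`, which has the same `C[2^M]`)
  `ker χ ⊋ 2^M C` by exactly one bit — the «lost bit at the bottom» of the sibling's risk note, now located: it can only occur at primes with
  `v₂(a_ℓ) = v₂(ℓ+1)` AND non-cyclic `Ẽ(𝔽_{ℓ²})[2^∞]`, never at sharp primes, never at regular primes.

Pure finite-abelian-group algebra (the consumer instantiates `C = Ẽ(𝔽_λ)[2^∞]`, `φ = Frob(ℓ)`, exactly as the tree's §2 shell of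
`HeegnerPointsKolyvaginPrimaryRamifiedProofs` does at odd `p`).  Nothing here proves the crux, `BSDp W 2`, BSD or the summit; no registered stub is
discharged.  BSD is not proved.

Refs: [McCallumLMS1991] §4 Prop. 4.4 (2) and proof («the `Gal(K/ℚ)`-eigenspaces of `E(F_λ)` are cyclic of order `l + 1 - Frob(l) a_l`»);
[GrossLMS1991] §6 Prop. 6.2 (2); [KolyvaginEulerSystems1990] Thm. 3.
-/

set_option linter.dupNamespace false -- tree convention: `Summit.BirchSwinnertonDyer.BirchSwinnertonDyer.Theorems` (summit = sub-problem)
set_option autoImplicit false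

noncomputable section

namespace Summit.BirchSwinnertonDyer.BirchSwinnertonDyer.Theorems.OffBigImageOddLocalAtTwo.Engine

open Literature.NumberTheory.EllipticCurves

namespace KolyvaginChiTwo

variable {C : Type*} [AddCommGroup C]

/-! ## §1  Unequal valuations: `ker χ = qC` for `q` coprime to `a'² - l'²`, no eigen-structure -/

/-- The endomorphism `χ(c) = a' c - l' φ(c)` is killed by `q` under the characteristic relation `(q l') c = (q a') φ(c)`
(`φ` an involution): `q χ(c) = q a' c - q l' φ c = q a' c - q a' φ(φ c) = 0`. [folklore] -/
theorem zsmul_chi_eq_zero (φ : C →+ C) (hφ : ∀ c, φ (φ c) = c) {q a' l' : ℤ}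
    (hchar : ∀ c : C, (q * l') • c = (q * a') • φ c) (c : C) :
    q • (a' • c - l' • φ c) = 0 := by
  have h := hchar (φ c)
  rw [hφ] at h
  rw [zsmul_sub, smul_smul, smul_smul, ← h, sub_self]

/-- On `ker χ`, `(a'² - l'²)` kills: `a' c = l' φ c ⇒ a'² c = a' l' φ c = l' φ (a' c) = l' φ (l' φ c) = l'² c`. [folklore] -/
theorem sq_sub_sq_zsmul_eq_zero_of_chi_eq_zero (φ : C →+ C) (hφ : ∀ c, φ (φ c) = c) {a' l' : ℤ} {c : C}
    (hc : a' • c - l' • φ c = 0) : (a' ^ 2 - l' ^ 2) • c = 0 := by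
  rw [sub_eq_zero] at hc
  have h1 : (a' * a') • c = (l' * l') • c := by
    calc (a' * a') • c = a' • (l' • φ c) := by rw [mul_zsmul, hc]
      _ = l' • φ (a' • c) := by rw [map_zsmul, zsmul_comm]
      _ = l' • φ (l' • φ c) := by rw [hc]
      _ = (l' * l') • c := by rw [map_zsmul, hφ, mul_zsmul]
  rw [sub_zsmul, sq, sq, h1]; abel

/-- **McCallum Prop. 4.4 (2) at ANY `p`, coprime case — `ker χ = qC` with no eigen-decomposition.**  `C` a finite abelian group, `φ` an additive
involution, integers `q, a', l'` with the characteristic relation `(q l') c = (q a') φ(c)` on `C` and `q` coprime to `a'² - l'²`.  Then for every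
`b`: `a' b - l' φ(b) = 0 ↔ b ∈ qC`.  At `q = 2^M`, `ℓ + 1 = 2^M l'`, `a_ℓ = 2^M a'` this is «`ker χ_ℓ = 2^M Ẽ(𝔽_λ)`» for every Kolyvagin prime at `2`
with `v₂(a_ℓ) ≠ v₂(ℓ+1)` (all sharp primes, all `a_ℓ = 0` primes), for ANY `ρ̄(Frob ℓ)`.  Proof: `im χ ⊆ C[q]` and `qC ⊆ ker χ` (`q χ = 0`); `χ` is
injective on `C[q]` (two coprime annihilators), hence bijective on the finite `C[q]`, so `im χ = C[q]` and `#ker χ = #C/#C[q] = #qC`.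
[cite: McCallumLMS1991, Prop. 4.4 (2)] -/
theorem sub_eq_zero_iff_exists_zsmul_eq_of_isCoprime [Finite C] (φ : C →+ C) (hφ : ∀ c, φ (φ c) = c)
    {q a' l' : ℤ} (hchar : ∀ c : C, (q * l') • c = (q * a') • φ c) (hcop : IsCoprime q (a' ^ 2 - l' ^ 2)) (b : C) :
    a' • b - l' • φ b = 0 ↔ ∃ y : C, q • y = b := by
  classical
  -- `χ` as an endomorphism
  set χ : C →+ C := AddMonoidHom.mk' (fun c ↦ a' • c - l' • φ c)
    (fun x y ↦ by simp only [map_add, zsmul_add]; abel) with hχdef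
  have hχ : ∀ c, χ c = a' • c - l' • φ c := fun c ↦ rfl
  -- multiplication by `q`
  set mq : C →+ C := zsmulAddGroupHom q with hmq
  have hmq_apply : ∀ c, mq c = q • c := fun c ↦ rfl
  constructor
  swap
  · -- `qC ⊆ ker χ`
    rintro ⟨y, rfl⟩
    rw [← hχ, map_zsmul, hχ, zsmul_chi_eq_zero φ hφ hchar]
  · intro hb
    -- `im χ ⊆ ker mq = C[q]`
    have him : χ.range ≤ mq.ker := by
      rintro _ ⟨c, rfl⟩
      rw [AddMonoidHom.mem_ker, hmq_apply, hχ, zsmul_chi_eq_zero φ hφ hchar]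
    -- `χ` is injective on `C[q]`, hence `C[q] ⊆ im χ`
    have hinj : ∀ c ∈ mq.ker, χ c = 0 → c = 0 := fun c hc h0 ↦ by
      rw [AddMonoidHom.mem_ker, hmq_apply] at hc
      exact KolyvaginChi.eq_zero_of_zsmul_eq_zero_of_isCoprime hcop hc
        (sq_sub_sq_zsmul_eq_zero_of_chi_eq_zero φ hφ (by rw [← hχ]; exact h0))
    have hχker : ∀ c ∈ mq.ker, χ c ∈ mq.ker := fun c _ ↦ him ⟨c, rfl⟩
    set χ' : mq.ker → mq.ker := fun c ↦ ⟨χ c, hχker c c.2⟩ with hχ'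
    have hχ'inj : Function.Injective χ' := by
      intro x y hxy
      have h1 : χ (x - y) = 0 := by
        rw [map_sub, sub_eq_zero]
        exact congrArg Subtype.val hxy
      exact Subtype.ext (sub_eq_zero.mp (hinj _ (mq.ker.sub_mem x.2 y.2) h1))
    have hχ'surj : Function.Surjective χ' := Finite.surjective_of_injective hχ'inj
    have hle : mq.ker ≤ χ.range := by
      intro c hc
      obtain ⟨x, hx⟩ := hχ'surj ⟨c, hc⟩
      exact ⟨x, congrArg Subtype.val hx⟩
    have heq : χ.range = mq.ker := le_antisymm him hle
    -- cardinalities: `#ker χ · #C[q] = #C = #C[q] · #qC`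
    have h1 : Nat.card C = Nat.card χ.range * Nat.card χ.ker := by
      rw [AddSubgroup.card_eq_card_quotient_mul_card_addSubgroup χ.ker,
        Nat.card_congr (QuotientAddGroup.quotientKerEquivRange χ).toEquiv]
    have h2 : Nat.card C = Nat.card mq.range * Nat.card mq.ker := by
      rw [AddSubgroup.card_eq_card_quotient_mul_card_addSubgroup mq.ker,
        Nat.card_congr (QuotientAddGroup.quotientKerEquivRange mq).toEquiv]
    rw [heq] at h1
    have hpos : 0 < Nat.card mq.ker := Nat.card_pos
    have hcard : Nat.card χ.ker = Nat.card mq.range := by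
      have : Nat.card mq.ker * Nat.card χ.ker = Nat.card mq.ker * Nat.card mq.range := by
        rw [← h1, h2, mul_comm]
      exact Nat.eq_of_mul_eq_mul_left hpos this
    -- `qC ⊆ ker χ`, same cardinality ⇒ equal
    have hsub : mq.range ≤ χ.ker := by
      rintro _ ⟨y, rfl⟩
      rw [AddMonoidHom.mem_ker, hmq_apply, map_zsmul, hχ, zsmul_chi_eq_zero φ hφ hchar]
    have hker : mq.range = χ.ker := AddSubgroup.eq_of_le_of_card_ge hsub hcard.le
    have hbker : b ∈ χ.ker := by rw [AddMonoidHom.mem_ker, hχ]; exact hb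
    rw [← hker] at hbker
    obtain ⟨y, hy⟩ := hbker
    exact ⟨y, hy⟩

/-! ## §2  Equal valuations: `ker χ = 2^M C` from the REGULAR (cyclic) `ℤ[φ]`-structure of `C` -/

/-- **McCallum Prop. 4.4 (2) at `p = 2`, equal-valuation case, REGULAR structure — `ker χ = 2^M C`.**  `C` a `2`-primary abelian group, `φ` an
additive involution with the characteristic relation `(2^M l') c = (2^M a') φ(c)`, `a'² ≠ l'²` (Hasse: `|a_ℓ| < ℓ + 1`), and `C` CYCLIC over `ℤ[φ]`:
a generator `g` (every `c = i•g + j•φ g`) whose relation lattice is the odd saturation of `⟨(2^M l', -2^M a'), (-2^M a', 2^M l')⟩` — the structure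
`ℤ₂[φ]/2^M (l' - a' φ)` of `Ẽ(𝔽_{ℓ²})[2^∞]` at a prime whose Frobenius is REGULAR (odd on `E[2]`).  Then `a' b - l' φ(b) = 0 ↔ b ∈ 2^M C`.
Proof: write `b = i•g + j•φ g`; `χ(b) = (a'i - l'j)•g + (a'j - l'i)•φ g = 0` gives an odd `k` and `x, y` with `k(a'i - l'j) = 2^M(l'x - a'y)`,
`k(a'j - l'i) = 2^M(l'y - a'x)`; with `u = ki + 2^M y`, `v = kj + 2^M x` this reads `a'u = l'v`, `a'v = l'u`, so `(a'² - l'²)u = 0`, `u = v = 0`,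
`k b = -2^M (y•g + x•φ g) ∈ 2^M C`, and `k` odd acts bijectively on the `2`-group `C`. [cite: McCallumLMS1991, Prop. 4.4 (2)] -/
theorem sub_eq_zero_iff_exists_pow_zsmul_eq_of_relations (φ : C →+ C) (hφ : ∀ c, φ (φ c) = c) {M : ℕ} {a' l' : ℤ}
    (hne : a' ^ 2 ≠ l' ^ 2) (hchar : ∀ c : C, ((2 : ℤ) ^ M * l') • c = ((2 : ℤ) ^ M * a') • φ c)
    (h2 : ∀ c : C, ∃ k : ℕ, ((2 : ℤ) ^ k) • c = 0)
    {g : C} (hgen : ∀ c : C, ∃ i j : ℤ, c = i • g + j • φ g)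
    (hrel : ∀ i j : ℤ, i • g + j • φ g = 0 → ∃ k x y : ℤ, Odd k ∧
      k * i = 2 ^ M * (l' * x - a' * y) ∧ k * j = 2 ^ M * (l' * y - a' * x))
    (b : C) :
    a' • b - l' • φ b = 0 ↔ ∃ y : C, ((2 : ℤ) ^ M) • y = b := by
  constructor
  swap
  · rintro ⟨y, rfl⟩
    rw [map_zsmul, smul_comm a', smul_comm l' ((2 : ℤ) ^ M), ← zsmul_sub, zsmul_chi_eq_zero φ hφ hchar]
  intro hb
  obtain ⟨i, j, rfl⟩ := hgen b
  -- `χ(b)` in the generators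
  have hχ : (a' * i - l' * j) • g + (a' * j - l' * i) • φ g = 0 := by
    have : a' • (i • g + j • φ g) - l' • φ (i • g + j • φ g) =
        (a' * i - l' * j) • g + (a' * j - l' * i) • φ g := by
      rw [map_add, map_zsmul, map_zsmul, hφ, zsmul_add, zsmul_add, smul_smul, smul_smul, smul_smul,
        smul_smul, sub_zsmul, sub_zsmul]
      abel
    rw [← this]; exact hb
  obtain ⟨k, x, y, hk, h1, h2'⟩ := hrel _ _ hχ
  -- `u = k i + 2^M y`, `v = k j + 2^M x` satisfy `a' u = l' v`, `a' v = l' u`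
  have hu : a' * (k * i + 2 ^ M * y) = l' * (k * j + 2 ^ M * x) := by linear_combination h1
  have hv : a' * (k * j + 2 ^ M * x) = l' * (k * i + 2 ^ M * y) := by linear_combination h2'
  have hu0 : k * i + 2 ^ M * y = 0 := by
    have h3 : (a' ^ 2 - l' ^ 2) * (k * i + 2 ^ M * y) = 0 := by linear_combination a' * hu + l' * hv
    rcases mul_eq_zero.mp h3 with h | h
    · exact absurd (sub_eq_zero.mp h) hne
    · exact h
  have hv0 : k * j + 2 ^ M * x = 0 := by
    have h3 : (a' ^ 2 - l' ^ 2) * (k * j + 2 ^ M * x) = 0 := by linear_combination a' * hv + l' * hu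
    rcases mul_eq_zero.mp h3 with h | h
    · exact absurd (sub_eq_zero.mp h) hne
    · exact h
  -- `k • b = -2^M (y•g + x•φ g)`
  have hkb : k • (i • g + j • φ g) = ((2 : ℤ) ^ M) • (-(y • g + x • φ g)) := by
    rw [zsmul_add, smul_smul, smul_smul, show k * i = -(2 ^ M * y) by linear_combination hu0,
      show k * j = -(2 ^ M * x) by linear_combination hv0, neg_zsmul, neg_zsmul, ← neg_add, zsmul_neg, zsmul_add,
      smul_smul, smul_smul]
  -- `k` odd acts bijectively on the `2`-group `C`: divide by `k`
  obtain ⟨n, hn⟩ := h2 (i • g + j • φ g)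
  have hcop : IsCoprime k ((2 : ℤ) ^ n) := by
    have : IsCoprime k 2 := by
      rw [Int.isCoprime_iff_gcd_eq_one]
      exact Int.isCoprime_iff_gcd_eq_one.mp ((Int.isCoprime_two_right.mpr hk))
    exact this.pow_right
  obtain ⟨α, β, hαβ⟩ := hcop
  refine ⟨α • (-(y • g + x • φ g)), ?_⟩
  calc ((2 : ℤ) ^ M) • α • (-(y • g + x • φ g))
      = α • (((2 : ℤ) ^ M) • (-(y • g + x • φ g))) := by rw [zsmul_comm]
    _ = α • (k • (i • g + j • φ g)) := by rw [hkb]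
    _ = (α * k + β * (2 : ℤ) ^ n) • (i • g + j • φ g) := by
        rw [add_zsmul, mul_zsmul, mul_zsmul, hn, zsmul_zero, add_zero]
    _ = i • g + j • φ g := by rw [hαβ, one_zsmul]

end KolyvaginChiTwo

end Summit.BirchSwinnertonDyer.BirchSwinnertonDyer.Theorems.OffBigImageOddLocalAtTwo.Engine

end
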